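import Summits.NavierStokesRegularity.NavierStokesRegularity.Theorems.HardyPointSinkHardyEnergyBoundAxisymmetric
import Summits.NavierStokesRegularity.NavierStokesRegularity.Theorems.CertifiedBlowupCertifiedBlowupAxisymBlowupIffNotAxisymRegular
import HarnessLib

/-!
# Route HardyPointSink — crux `HardyEnergyBound` (item stmt-NavierStokesRegularity-7979):
# cross-route edge — the crux of route CertifiedBlowup kills the crux of route HardyPointSink

Support file (theorems only, `--supports stmt-NavierStokesRegularity-7979`; lead c5 of the crux
line, 2026-08-17).  The crux `CertifiedBlowupAxisymBlowup` of route `CertifiedBlowup`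
(stmt-NavierStokesRegularity-0727: some finite-energy classical Navier–Stokes solution from a
rapidly decaying axisymmetric datum is maximal with finite lifespan — Hou's scenario,
arXiv:2107.06509, made a theorem) is, by the landed
`certifiedBlowupAxisymBlowup_iff_not_axisymmetricSwirlRegularity_summit`, exactly the negation of
the conjecture leaf `AxisymmetricSwirlRegularity` (ns.S25); and the crux `HardyEnergyBound` (C2) of
route `HardyPointSink` implies that leaf modulo Seregin 2020 Thm 2.1
(`axisymmetricSwirlRegularity_of_hardyEnergyBound`).  Hence:

* `hardyEnergyBound_false_of_certifiedBlowupAxisymBlowup` —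
  `Seregin2020_axisymmetricSingularPoint_typeII → CertifiedBlowupAxisymBlowup → ¬ HardyEnergyBound`:
  if route CertifiedBlowup closes its crux 0727, route HardyPointSink's crux 7979 is REFUTED
  (modulo the printed theorem Seregin 2020, whose in-tree proof is in progress) — whatever the tail
  of the axisymmetric singularity;
* `not_certifiedBlowupAxisymBlowup_of_hardyEnergyBound` — the contrapositive edge.

References: G. Seregin, Anal. Math. Phys. 10 (2020), Paper 46, Thm 2.1 [Seregin2020]; T. Y. Hou,
arXiv:2107.06509 [Hou2022PotentiallySingularNS]; G. Koch, N. Nadirashvili, G. Seregin, V. Šverák,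
Acta Math. 203 (2009) [KNSS2009].
-/

noncomputable section

-- the summit and its single sub-problem share the name (CONVENTIONS §1), as in every Theorems file
set_option linter.dupNamespace false

open Literature.Analysis.FluidPDE

namespace Summit.NavierStokesRegularity.NavierStokesRegularity.Theorems

/-- **Cross-route edge: an axisymmetric Clay blow-up (the crux of route CertifiedBlowup) refutes
`HardyEnergyBound` (the crux of route HardyPointSink), modulo Seregin 2020, Thm 2.1.**
`CertifiedBlowupAxisymBlowup ↔ ¬ AxisymmetricSwirlRegularity`
(`CertifiedBlowupAxisymBlowup.CompactAmplification.certifiedBlowupAxisymBlowup_iff_not_axisymmetricSwirlRegularity_summit`)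
and
`Seregin2020 → HardyEnergyBound → AxisymmetricSwirlRegularity`
(`axisymmetricSwirlRegularity_of_hardyEnergyBound`). [cite: Seregin2020, Thm 2.1] -/
theorem hardyEnergyBound_false_of_certifiedBlowupAxisymBlowup :
    Literature.Analysis.FluidPDE.Seregin2020_axisymmetricSingularPoint_typeII →
    Summit.NavierStokesRegularity.NavierStokesRegularity.Theses.CertifiedBlowup.CertifiedBlowupAxisymBlowup →
    ¬ Summit.NavierStokesRegularity.NavierStokesRegularity.Theses.HardyPointSink.HardyEnergyBound :=
  fun hSer hB hC2 =>
    (CertifiedBlowupAxisymBlowup.CompactAmplification.certifiedBlowupAxisymBlowup_iff_not_axisymmetricSwirlRegularity_summit.1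
        hB)
      (axisymmetricSwirlRegularity_of_hardyEnergyBound hSer hC2)

/-- **The contrapositive edge**: modulo Seregin 2020, `HardyEnergyBound` forbids the axisymmetric
blow-up scenario of route CertifiedBlowup (its crux 0727 is then false). [cite: Seregin2020, Thm 2.1] -/
theorem not_certifiedBlowupAxisymBlowup_of_hardyEnergyBound
    (hSer : Seregin2020_axisymmetricSingularPoint_typeII)
    (hC2 : Theses.HardyPointSink.HardyEnergyBound) :
    ¬ Theses.CertifiedBlowup.CertifiedBlowupAxisymBlowup := fun hB =>
  hardyEnergyBound_false_of_certifiedBlowupAxisymBlowup hSer hB hC2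

end Summit.NavierStokesRegularity.NavierStokesRegularity.Theorems

end
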